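import Mathlib
import Literature.Computability.Complexity.NullstellensatzRefutation
import Literature.Computability.AlgebraicComplexity.PermanentIrreducible
import Literature.Computability.AlgebraicComplexity.MatMulRankLowerBoundsProofs

/-!
# Degree-`0` refutations below the permanent's degree — line `Sketch` of crux `CertWindowQP`
(stmt-ValiantsHypothesis-5640)

Stub `stub_nsSmall` of the registered skeleton. The system `Rep(n,m)` has as axioms the
`x`-coefficients of the defect `det (A₀ + ∑_e x_e A_e) - per_n(x)`, the unknowns being the entries
of the `m × m` matrices `A₀` (tag `none`) and `A_e` (tag `some e`). For `m < n` it has a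
Nullstellensatz refutation of degree `0`: every entry of the generic affine pencil has
`x`-total-degree `≤ 1`, so its determinant has `x`-total-degree `≤ m < n`
(`totalDegree_det_le`) and its coefficient at the diagonal permutation monomial `∏_i x_{ii}`
(weight `n`) vanishes, while that monomial has coefficient `1` in `per_n`
(`coeff_permMonomial_perPoly`). Hence the axiom at that monomial is the constant `-1`, and the
single multiplier `-1` refutes the system in degree `0`.
-/

open scoped BigOperators
open MvPolynomial

namespace Summit.ValiantsHypothesis.ValiantsHypothesis.Theorems

open Literature.Computability.AlgebraicComplexity Literature.Computability.Complexity

/-- An entry `C a + ∑_e X_e · C (b e)` of an affine pencil has total degree `≤ 1`. -/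
private theorem totalDegree_pencilEntry_le {σ R : Type*} [CommSemiring R] [Nontrivial R]
    [Fintype σ] (a : R) (b : σ → R) :
    (C a + ∑ e : σ, X e * C (b e) : MvPolynomial σ R).totalDegree ≤ 1 := by
  refine (totalDegree_add _ _).trans (max_le ?_ ?_)
  · rw [totalDegree_C]
    exact Nat.zero_le _
  · refine totalDegree_finsetSum_le fun e _ => (totalDegree_mul _ _).trans ?_
    rw [totalDegree_C, add_zero, totalDegree_X]

/-- The diagonal permutation monomial `∑_i e_{(i,i)}` of `Fin n` has weight `n`. -/
private theorem sum_support_permMonomial_one (n : ℕ) :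
    (∑ v ∈ (permMonomial (1 : Equiv.Perm (Fin n))).support,
      permMonomial (1 : Equiv.Perm (Fin n)) v) = n := by
  rw [← Finsupp.degree_apply, permMonomial, map_sum]
  simp [Finsupp.degree_single]

/-- Below the degree of the permanent (`m < n`) the system `Rep(n,m)` has a Nullstellensatz
refutation of degree `0`: the axiom at the diagonal permutation monomial is the constant `-1`
(`det (A₀ + ∑ x_e A_e)` has `x`-degree `≤ m < n`, and that monomial has coefficient `1` in
`per_n`). Stub `stub_nsSmall` of line `Sketch` of crux `CertWindowQP`. -/
theorem certWindowQP_nsSmall (n m : ℕ) (hmn : m < n) :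
    HasNSRefutationOfDegree (fun μ : (Fin n × Fin n) →₀ ℕ =>
      ((Matrix.of fun i j : Fin m => MvPolynomial.C (MvPolynomial.X (none, (i, j))) + ∑ e : Fin n × Fin n, MvPolynomial.X e * MvPolynomial.C (MvPolynomial.X (some e, (i, j))) : Matrix (Fin m) (Fin m) (MvPolynomial (Fin n × Fin n) (MvPolynomial (Option (Fin n × Fin n) × (Fin m × Fin m)) ℂ))).det - MvPolynomial.map MvPolynomial.C (Literature.Computability.AlgebraicComplexity.perPoly (Fin n) ℂ)).coeff μ) 0 := by
  classical
  set M : Matrix (Fin m) (Fin m)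
      (MvPolynomial (Fin n × Fin n) (MvPolynomial (Option (Fin n × Fin n) × (Fin m × Fin m)) ℂ)) :=
    Matrix.of fun i j : Fin m => MvPolynomial.C (MvPolynomial.X (none, (i, j))) +
      ∑ e : Fin n × Fin n, MvPolynomial.X e * MvPolynomial.C (MvPolynomial.X (some e, (i, j)))
    with hM
  -- the determinant of the pencil has `x`-degree `≤ m`
  have hdeg : M.det.totalDegree ≤ m := by
    have h := totalDegree_det_le M fun i j => by
      rw [hM, Matrix.of_apply]
      exact totalDegree_pencilEntry_le _ _
    simpa using h
  -- so its coefficient at the diagonal permutation monomial (weight `n > m`) vanishes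
  have hcoeff : M.det.coeff (permMonomial (1 : Equiv.Perm (Fin n))) = 0 := by
    apply coeff_eq_zero_of_totalDegree_lt
    rw [sum_support_permMonomial_one]
    exact lt_of_le_of_lt hdeg hmn
  -- the axiom at that monomial is the constant `-1`
  have hax : (M.det - MvPolynomial.map MvPolynomial.C (perPoly (Fin n) ℂ)).coeff
      (permMonomial (1 : Equiv.Perm (Fin n))) = -1 := by
    rw [coeff_sub, hcoeff, coeff_map, coeff_permMonomial_perPoly, map_one, zero_sub]
  refine ⟨{permMonomial 1}, fun _ => -1, ?_, ?_⟩
  · rw [Finset.sum_singleton]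
    beta_reduce
    rw [hax]
    simp
  · intro a ha
    rw [Finset.mem_singleton] at ha
    subst ha
    beta_reduce
    rw [hax]
    simp

/-- **Registered stub `stub_nsSmall`** of line `Sketch` (crux `CertWindowQP`, stmt-ValiantsHypothesis-5640),
verbatim signature of the registered skeleton `Cruxes/CertWindowQP/Lines/Sketch.lean`; proved by the
theorem above. -/
theorem stub_nsSmall (n m : ℕ) (hmn : m < n) :
    HasNSRefutationOfDegree (fun μ : (Fin n × Fin n) →₀ ℕ =>
      ((Matrix.of fun i j : Fin m => MvPolynomial.C (MvPolynomial.X (none, (i, j))) + ∑ e : Fin n × Fin n, MvPolynomial.X e * MvPolynomial.C (MvPolynomial.X (some e, (i, j))) : Matrix (Fin m) (Fin m) (MvPolynomial (Fin n × Fin n) (MvPolynomial (Option (Fin n × Fin n) × (Fin m × Fin m)) ℂ))).det - MvPolynomial.map MvPolynomial.C (Literature.Computability.AlgebraicComplexity.perPoly (Fin n) ℂ)).coeff μ) 0 :=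
  certWindowQP_nsSmall n m hmn

end Summit.ValiantsHypothesis.ValiantsHypothesis.Theorems
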